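import Summits.AtomisticToContinuum.Crystallization.Theorems.FrustratedLawDichotomyAperiodicGapRecordJunctionTail
import Summits.AtomisticToContinuum.Crystallization.Theorems.FrustratedLawDichotomyStrainedPatchRowPrice
import Summits.AtomisticToContinuum.Crystallization.Theorems.FrustratedLawDichotomyStrainedPatchHomEntryLeafHTUCentredRot
import HarnessLib

/-!
# FrustratedLawDichotomy · crux `AperiodicFrustratedLawGap` (stmt-AtomisticToContinuum-27623) — RECORD JUNCTION, ROW-PRICED FORM (R1⁗)
# (decomp-a2c, lens-5 generation 75 for prover hand 2; structural share, sequel of `…AperiodicGapRecordJunctionFold`)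

Census FINAL rev 2 (ASK-73 / SLACK-36; critic rows 1230/1247) leaves the rim-folded descent R1‴ (`…RimFold.coreOff_of_envelope_tailCert_fold`, junction
`…RecordJunctionFold`) short at `τ = 1/100` under the honest exterior column: the UNIFORM step target `k (i+1) · σ₁` must beat the price of the dearest inner
row (`≈ 12 σ₁` near `R_X`) while the terminal LP tolerates a uniform `k n ≲ 0.82` (HZ00) — although its dual multipliers sit on the CORE rows, whose price is
`≈ 1.4 σ₁`.  lens-5 g75 (`…StrainedPatchRowPrice`) replaces the uniform targets by PER-ROW TABLES `P i : SlackTab` absorbed into the column: the stage-`i`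
polytope is `InForcePolytope 0 σ₁ hessBlk0 force0 (addCol X (P i))`, the terminal certificate `SlackCert 𝓘 τ 0 σ₁ hessBlk0 force0 (addCol X (P n))` (census
LP with row slack `σ₁ + X(h) + P n (h)`; its value is bounded from the existing certificate's duals by RHS-convexity).  R1‴ and g71's uniform descent are the
two-valued / constant instances (`…RowPrice.coreOff_of_envelope_tailCert_fold_via_tab`, `…tubeFloor_of_descent_via_tab`).  This DEF-FREE module threads
R1⁗ to the crux exactly as `…RecordJunctionFold` threads R1‴, against the hcp E-consumer OF RECORD `homFloor_625_of_entryTrees6RBKP_HT4UQDCRX` (critic row 1238):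
* §1 `strainedPatchRec_of_homFloor_625_of_envelope_tailCert_tab` / `…_of_gammaTable_tailCert_tab`;
* §2 the crux BY NAME `aperiodicFrustratedLawGap_of_entryTreesU_of_envelope_tailCert_tab` (+ periodic sibling 27624) and the γ-table form;
* §3 sanity at the cell width of record `τ = 1/100` with ONE per-row step (side conditions `1/50 < s₀`, `r ≤ 349/50`).

T-SIDE BINDER CENSUS after this file (every binder family-level, per-host or per-host-row; none cluster-quantified): FamilyCover 𝓘 (24/5) (1/100) (1/8) τ ·
HostSep 𝓘 s₀ · HostFarTab 𝓘 τ r Xh · TailCert 𝓘 τ Xe · column domination Xh + Xe ≤ X · HostTopTab (per-row box tops `P 0`) · HostStepTab-table (per-row steps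
`P i ↦ P (i+1)` on the columns `addCol X (P i)`) · SlackCert at `κ = 0` on `addCol X (P n)` (+ the numeric side conditions 0 ≤ τ, 2τ < s₀, r + 2τ ≤ 7).
One-line compositions of tree theorems; 0 sorry; no definitions; standard axioms.  `--supports stmt-AtomisticToContinuum-27623`.
[folklore instantiation]
-/

noncomputable section

namespace Summit.AtomisticToContinuum.Crystallization.Theorems.FrustratedLawDichotomyAperiodicGapRecordJunctionTab

open Summit.AtomisticToContinuum.Crystallization.Theorems.ChargedEnergyGapNegative (eStar E3)
open Summit.AtomisticToContinuum.Crystallization.Theorems.FrustratedLawDichotomyRangeCut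
open Summit.AtomisticToContinuum.Crystallization.Theorems.FrustratedLawDichotomySchurCut
open Summit.AtomisticToContinuum.Crystallization.Theorems.FrustratedLawDichotomyMotifLemmas (GoodAtScale)
open Summit.AtomisticToContinuum.Crystallization.Theorems.FrustratedLawDichotomyExemptLocOpt (LocOptFails)
open Summit.AtomisticToContinuum.Crystallization.Theorems.FrustratedLawDichotomyExemptSplit (SchurElasticPricingX)
open Summit.AtomisticToContinuum.Crystallization.Theorems.FrustratedLawDichotomyExemptAbsorptionRecord
open Summit.AtomisticToContinuum.Crystallization.Theorems.FrustratedLawDichotomyCollarCensus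
open Summit.AtomisticToContinuum.Crystallization.Theorems.FrustratedLawDichotomyCollarCensusKappa
open Summit.AtomisticToContinuum.Crystallization.Theorems.FrustratedLawDichotomyStrainedPatchHomSplit
open Summit.AtomisticToContinuum.Crystallization.Theorems.FrustratedLawDichotomyStrainedPatchCleanCollar (TailPenalty AnnularDefectFloor DefectiveCollarFloor)
open Summit.AtomisticToContinuum.Crystallization.Theorems.FrustratedLawDichotomyStrainedPatchPhaseCut (AnnularPhaseFloor PolyTextureFloor)
open Summit.AtomisticToContinuum.Crystallization.Theorems.FrustratedLawDichotomyStrainedPatchCoreTube (CoreOffTubeFloor)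
open Summit.AtomisticToContinuum.Crystallization.Theorems.FrustratedLawDichotomyStrainedPatchCoreTubeRecord (CoreCoreRelief seam_arith_core
  strainedPatchRec_of_homFloor_of_tailPenalty_of_coreRelief_of_coreOff_of_annularPhase_of_poly_of_annular_of_near)
open Summit.AtomisticToContinuum.Crystallization.Theorems.FrustratedLawDichotomyStrainedPatchHostCells (FamP FamilyCover)
open Summit.AtomisticToContinuum.Crystallization.Theorems.FrustratedLawDichotomyStrainedPatchHomCertTree (CertTree treeOK)
open Summit.AtomisticToContinuum.Crystallization.Theorems.FrustratedLawDichotomyStrainedPatchHomEntryGram (rootC rootW)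
open Summit.AtomisticToContinuum.Crystallization.Theorems.FrustratedLawDichotomyStrainedPatchHomEntryGramHcp (rootCH rootWH)
open Summit.AtomisticToContinuum.Crystallization.Theorems.FrustratedLawDichotomyStrainedPatchHomEntryTable (muRec)
open Summit.AtomisticToContinuum.Crystallization.Theorems.FrustratedLawDichotomyStrainedPatchHomEntryTableP (entryLeafOK6RBKP)
open Summit.AtomisticToContinuum.Crystallization.Theorems.FrustratedLawDichotomyStrainedPatchHomEntryLeafHT (HTCert entryLeafOKHT4UQDCRX
  homFloor_625_of_entryTrees6RBKP_HT4UQDCRX)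
open Summit.AtomisticToContinuum.Crystallization.Theorems.FrustratedLawDichotomyStrainedPatchQuantSlaving (ChartFam HessTab ForceTab SlackTab hessBlk0 force0)
open Summit.AtomisticToContinuum.Crystallization.Theorems.FrustratedLawDichotomyStrainedPatchSVCharge (SlackCert)
open Summit.AtomisticToContinuum.Crystallization.Theorems.FrustratedLawDichotomyStrainedPatchTaylorCharge (HostSep cubicTail)
open Summit.AtomisticToContinuum.Crystallization.Theorems.FrustratedLawDichotomyStrainedPatchBondCalculus (bondD3 bondGamma)
open Summit.AtomisticToContinuum.Crystallization.Theorems.FrustratedLawDichotomyStrainedPatchFarSplit (HostFarTab gammaMaj)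
open Summit.AtomisticToContinuum.Crystallization.Theorems.FrustratedLawDichotomyStrainedPatchTailPacking (TailCert)
open Summit.AtomisticToContinuum.Crystallization.Theorems.FrustratedLawDichotomyAperiodicGapRecordJunction
open Summit.AtomisticToContinuum.Crystallization.Theorems.FrustratedLawDichotomyStrainedPatchRowPrice (HostTopTab HostStepTab addCol
  coreOff_of_envelope_tailCert_tab coreOff_of_gammaTable_tailCert_tab)

/-! ## §1 `StrainedPatchRec` from R1⁗ -/

/-- ★★★ **R1⁗ ⟹ StrainedPatchRec (envelope form, row-priced)**: `HomFloor (1/625) ∧ TailPenalty (24/5) (1/1000) ∧ CoreCoreRelief … (3/5000) ∧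
FamilyCover 𝓘 (24/5) (1/100) (1/8) τ ∧ 2τ < s₀ ∧ HostSep 𝓘 s₀ ∧ r + 2τ ≤ 7 ∧ HostFarTab 𝓘 τ r Xh ∧ TailCert 𝓘 τ Xe ∧ (Xh + Xe ≤ X) ∧
HostTopTab (P 0) ∧ HostStepTab-table `P i ↦ P (i+1)` with the closed-form tail `cubicTail (s ↦ gammaMaj (s − 2τ))` on the columns `addCol X (P i)` ∧
SlackCert … 0 … (addCol X (P n)) ∧ AnnularPhaseFloor ∧ PolyTextureFloor ∧ AnnularDefectFloor ∧ DefectiveCollarFloor ⟹ StrainedPatchRec`.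
[folklore instantiation: `…CoreTubeRecord.strainedPatchRec_of_homFloor_of_…` with `hC := …RowPrice.coreOff_of_envelope_tailCert_tab`] -/
theorem strainedPatchRec_of_homFloor_625_of_envelope_tailCert_tab {𝓘 : ChartFam} {τ s₀ r : ℝ} {X Xh Xe : SlackTab} (P : ℕ → SlackTab) (n : ℕ)
    (hτ : 0 ≤ τ)
    (hHF : HomFloor (1 / 625)) (hT : TailPenalty (24 / 5) (1 / 1000)) (hRl : CoreCoreRelief (63 / 10) (63 / 10) (24 / 5) (1 / 100) (3 / 5000))
    (hFC : FamilyCover 𝓘 (24 / 5) (1 / 100) (1 / 8) τ) (hτs : 2 * τ < s₀) (hsep : HostSep 𝓘 s₀) (hr7 : r + 2 * τ ≤ 7)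
    (hH : HostFarTab 𝓘 τ r Xh) (hTC : TailCert 𝓘 τ Xe)
    (hdom : ∀ (M₀ : ℕ) (z₀ : Fin M₀ → E3) (c₀ h : Fin M₀), Xh M₀ z₀ c₀ h + Xe M₀ z₀ c₀ h ≤ X M₀ z₀ c₀ h)
    (h0 : HostTopTab 𝓘 τ bondD3 (cubicTail fun s => gammaMaj (s - 2 * τ)) r (P 0))
    (hs : ∀ i : ℕ, i < n →
      HostStepTab 𝓘 τ sigmaOne bondD3 (cubicTail fun s => gammaMaj (s - 2 * τ)) r hessBlk0 force0 (addCol X (P i)) (P (i + 1)))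
    (hC : SlackCert 𝓘 τ 0 sigmaOne hessBlk0 force0 (addCol X (P n)))
    (hF : AnnularPhaseFloor (63 / 10) (24 / 5) (63 / 10) (1 / 1000)) (hP : PolyTextureFloor (63 / 10) (24 / 5) (1 / 1000))
    (hA : AnnularDefectFloor (24 / 5) (63 / 10)) (hD : DefectiveCollarFloor (24 / 5)) : StrainedPatchRec :=
  strainedPatchRec_of_homFloor_of_tailPenalty_of_coreRelief_of_coreOff_of_annularPhase_of_poly_of_annular_of_near (by norm_num) hHF hT hRl
    seam_arith_core (coreOff_of_envelope_tailCert_tab P n hτ hFC hτs hsep hr7 hH hTC hdom h0 hs hC) hF hP le_rfl (by norm_num) (by norm_num) hA hD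

/-- ★★★ **R1⁗ ⟹ StrainedPatchRec (census γ-table form, row-priced)**: the same with a γ-table `bondGamma ≤ L` on the `2τ`-bands and the tail `cubicTail L`.
[folklore instantiation: `hC := …RowPrice.coreOff_of_gammaTable_tailCert_tab`] -/
theorem strainedPatchRec_of_homFloor_625_of_gammaTable_tailCert_tab {𝓘 : ChartFam} {τ s₀ r : ℝ} {L : ℝ → ℝ} {X Xh Xe : SlackTab} (P : ℕ → SlackTab)
    (n : ℕ) (hτ : 0 ≤ τ)
    (hHF : HomFloor (1 / 625)) (hT : TailPenalty (24 / 5) (1 / 1000)) (hRl : CoreCoreRelief (63 / 10) (63 / 10) (24 / 5) (1 / 100) (3 / 5000))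
    (hFC : FamilyCover 𝓘 (24 / 5) (1 / 100) (1 / 8) τ) (hτs : 2 * τ < s₀)
    (hL : ∀ s : ℝ, s₀ ≤ s → s < r → ∀ s' : ℝ, |s' - s| ≤ 2 * τ → bondGamma s' ≤ L s) (hsep : HostSep 𝓘 s₀) (hr7 : r + 2 * τ ≤ 7)
    (hH : HostFarTab 𝓘 τ r Xh) (hTC : TailCert 𝓘 τ Xe)
    (hdom : ∀ (M₀ : ℕ) (z₀ : Fin M₀ → E3) (c₀ h : Fin M₀), Xh M₀ z₀ c₀ h + Xe M₀ z₀ c₀ h ≤ X M₀ z₀ c₀ h)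
    (h0 : HostTopTab 𝓘 τ bondD3 (cubicTail L) r (P 0))
    (hs : ∀ i : ℕ, i < n → HostStepTab 𝓘 τ sigmaOne bondD3 (cubicTail L) r hessBlk0 force0 (addCol X (P i)) (P (i + 1)))
    (hC : SlackCert 𝓘 τ 0 sigmaOne hessBlk0 force0 (addCol X (P n)))
    (hF : AnnularPhaseFloor (63 / 10) (24 / 5) (63 / 10) (1 / 1000)) (hP : PolyTextureFloor (63 / 10) (24 / 5) (1 / 1000))
    (hA : AnnularDefectFloor (24 / 5) (63 / 10)) (hD : DefectiveCollarFloor (24 / 5)) : StrainedPatchRec :=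
  strainedPatchRec_of_homFloor_of_tailPenalty_of_coreRelief_of_coreOff_of_annularPhase_of_poly_of_annular_of_near (by norm_num) hHF hT hRl
    seam_arith_core (coreOff_of_gammaTable_tailCert_tab P n hτ hFC hτs hL hsep hr7 hH hTC hdom h0 hs hC) hF hP le_rfl (by norm_num) (by norm_num) hA hD

/-! ## §2 The crux BY NAME from the entry trees (hcp: the HTU consumer of record) and R1⁗ -/

/-- ★★★ **27623 FROM THE ENTRY TREES AND R1⁗ (envelope form, row-priced)** — the record junction with NO cluster-quantified T-side binder and the hcp
E-consumer of record `entryLeafOKHT4UQDCRX` (critic row 1238): the crux BY NAME from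
`UP ∧ 0 ≤ D_X ∧ Eopt-raw ∧ (∃ fcc tree) ∧ (∃ hcp HT4UQDCRX tree) ∧ TailPenalty ∧ CoreCoreRelief ∧ FamilyCover ∧ 2τ < s₀ ∧ HostSep ∧ r + 2τ ≤ 7 ∧ HostFarTab ∧
TailCert ∧ (Xh + Xe ≤ X) ∧ HostTopTab (P 0) ∧ HostStepTab-table ∧ SlackCert at κ = 0 on `addCol X (P n)` ∧ AnnularPhaseFloor ∧ PolyTextureFloor ∧
AnnularDefectFloor ∧ DefectiveCollarFloor ∧ CC∪T₀ ∧ DD∪T₀`. [folklore instantiation] -/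
theorem aperiodicFrustratedLawGap_of_entryTreesU_of_envelope_tailCert_tab {𝓘 : ChartFam} {τ s₀ r : ℝ} {X Xh Xe : SlackTab}
    {εE CE DE DX : ℝ} (P : ℕ → SlackTab) (n : ℕ) (hτ : 0 ≤ τ)
    (hε0 : 0 < εE) (hε1 : εE ≤ 1 / 10000) (hU : PeriodicEnergyCeiling (-(7175 / 10000))) (hDX : 0 ≤ DX)
    (hE : SchurElasticPricingX (1 / 20) (1 / 8) w₄₅ ω₄ (3 / 400) (-(7175 / 10000)) (1 / 10000) CE DE DX (LocOptFails eStar εE (3 / 2) 1))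
    (Pc : ((Fin 3 × Fin 3) ⊕ Fin 3 → ℤ) → ((Fin 3 × Fin 3) ⊕ Fin 3 → ℤ) → HTCert)
    (Qf : ((Fin 3 × Fin 3) ⊕ Fin 3 → ℤ) → ((Fin 3 × Fin 3) ⊕ Fin 3 → ℤ) → (Fin 4 → ℤ))
    (T : ((Fin 3 × Fin 3) ⊕ Fin 3 → ℤ) → ((Fin 3 × Fin 3) ⊕ Fin 3 → ℤ) → CertTree ((Fin 3 × Fin 3) ⊕ Fin 3))
    (hFcc : ∃ t : CertTree (Fin 3 × Fin 3), treeOK (entryLeafOK6RBKP muRec) t rootC rootW = true)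
    (hHcp : ∃ t : CertTree ((Fin 3 × Fin 3) ⊕ Fin 3), treeOK (entryLeafOKHT4UQDCRX muRec Pc Qf T) t rootCH rootWH = true)
    (hT : TailPenalty (24 / 5) (1 / 1000)) (hRl : CoreCoreRelief (63 / 10) (63 / 10) (24 / 5) (1 / 100) (3 / 5000))
    (hFC : FamilyCover 𝓘 (24 / 5) (1 / 100) (1 / 8) τ) (hτs : 2 * τ < s₀) (hsep : HostSep 𝓘 s₀) (hr7 : r + 2 * τ ≤ 7)
    (hH : HostFarTab 𝓘 τ r Xh) (hTC : TailCert 𝓘 τ Xe)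
    (hdom : ∀ (M₀ : ℕ) (z₀ : Fin M₀ → E3) (c₀ h : Fin M₀), Xh M₀ z₀ c₀ h + Xe M₀ z₀ c₀ h ≤ X M₀ z₀ c₀ h)
    (h0 : HostTopTab 𝓘 τ bondD3 (cubicTail fun s => gammaMaj (s - 2 * τ)) r (P 0))
    (hs : ∀ i : ℕ, i < n →
      HostStepTab 𝓘 τ sigmaOne bondD3 (cubicTail fun s => gammaMaj (s - 2 * τ)) r hessBlk0 force0 (addCol X (P i)) (P (i + 1)))
    (hC : SlackCert 𝓘 τ 0 sigmaOne hessBlk0 force0 (addCol X (P n)))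
    (hF : AnnularPhaseFloor (63 / 10) (24 / 5) (63 / 10) (1 / 1000)) (hP : PolyTextureFloor (63 / 10) (24 / 5) (1 / 1000))
    (hA : AnnularDefectFloor (24 / 5) (63 / 10)) (hD : DefectiveCollarFloor (24 / 5))
    (h2 : CrowdedCoreMotifPricingCapK (1 / 1000) (9 / 5) (133 / 10) (3 / 2) (effPot w₄₅ ω₄ (3 / 400)) (-(7175 / 10000) + 3 / 400)
      (Collar (9 / 2) fun N y j => (∃ s : ℝ, 0 ≤ s ∧ s ≤ 3 / 2 ∧ NonEquilibriumCore (-(7175 / 10000)) 0 7 s (1 / 10000) N y j) ∨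
        GoodAtScale (1 / 20) (3 / 2) y j))
    (h3 : DiluteDefectMotifPricingCapK (1 / 1000) (9 / 5) (133 / 10) (3 / 2) (effPot w₄₅ ω₄ (3 / 400)) (-(7175 / 10000) + 3 / 400)
      (Collar (9 / 2) fun N y j => (∃ s : ℝ, 0 ≤ s ∧ s ≤ 3 / 2 ∧ NonEquilibriumCore (-(7175 / 10000)) 0 7 s (1 / 10000) N y j) ∨
        GoodAtScale (1 / 20) (3 / 2) y j)) :
    Summit.AtomisticToContinuum.Crystallization.Theses.FrustratedLawDichotomy.AperiodicFrustratedLawGap :=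
  aperiodicFrustratedLawGap_of_strainedPatchRec hε0 hε1 hU hDX hE
    (strainedPatchRec_of_homFloor_625_of_envelope_tailCert_tab P n hτ (homFloor_625_of_entryTrees6RBKP_HT4UQDCRX Pc Qf T hFcc hHcp) hT hRl hFC
      hτs hsep hr7 hH hTC hdom h0 hs hC hF hP hA hD) h2 h3

/-- ★★ **Periodic sibling (27624)** of `aperiodicFrustratedLawGap_of_entryTreesU_of_envelope_tailCert_tab`. [folklore instantiation] -/
theorem periodicFrustratedLawGap_of_entryTreesU_of_envelope_tailCert_tab {𝓘 : ChartFam} {τ s₀ r : ℝ} {X Xh Xe : SlackTab}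
    {εE CE DE DX : ℝ} (P : ℕ → SlackTab) (n : ℕ) (hτ : 0 ≤ τ)
    (hε0 : 0 < εE) (hε1 : εE ≤ 1 / 10000) (hU : PeriodicEnergyCeiling (-(7175 / 10000))) (hDX : 0 ≤ DX)
    (hE : SchurElasticPricingX (1 / 20) (1 / 8) w₄₅ ω₄ (3 / 400) (-(7175 / 10000)) (1 / 10000) CE DE DX (LocOptFails eStar εE (3 / 2) 1))
    (Pc : ((Fin 3 × Fin 3) ⊕ Fin 3 → ℤ) → ((Fin 3 × Fin 3) ⊕ Fin 3 → ℤ) → HTCert)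
    (Qf : ((Fin 3 × Fin 3) ⊕ Fin 3 → ℤ) → ((Fin 3 × Fin 3) ⊕ Fin 3 → ℤ) → (Fin 4 → ℤ))
    (T : ((Fin 3 × Fin 3) ⊕ Fin 3 → ℤ) → ((Fin 3 × Fin 3) ⊕ Fin 3 → ℤ) → CertTree ((Fin 3 × Fin 3) ⊕ Fin 3))
    (hFcc : ∃ t : CertTree (Fin 3 × Fin 3), treeOK (entryLeafOK6RBKP muRec) t rootC rootW = true)
    (hHcp : ∃ t : CertTree ((Fin 3 × Fin 3) ⊕ Fin 3), treeOK (entryLeafOKHT4UQDCRX muRec Pc Qf T) t rootCH rootWH = true)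
    (hT : TailPenalty (24 / 5) (1 / 1000)) (hRl : CoreCoreRelief (63 / 10) (63 / 10) (24 / 5) (1 / 100) (3 / 5000))
    (hFC : FamilyCover 𝓘 (24 / 5) (1 / 100) (1 / 8) τ) (hτs : 2 * τ < s₀) (hsep : HostSep 𝓘 s₀) (hr7 : r + 2 * τ ≤ 7)
    (hH : HostFarTab 𝓘 τ r Xh) (hTC : TailCert 𝓘 τ Xe)
    (hdom : ∀ (M₀ : ℕ) (z₀ : Fin M₀ → E3) (c₀ h : Fin M₀), Xh M₀ z₀ c₀ h + Xe M₀ z₀ c₀ h ≤ X M₀ z₀ c₀ h)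
    (h0 : HostTopTab 𝓘 τ bondD3 (cubicTail fun s => gammaMaj (s - 2 * τ)) r (P 0))
    (hs : ∀ i : ℕ, i < n →
      HostStepTab 𝓘 τ sigmaOne bondD3 (cubicTail fun s => gammaMaj (s - 2 * τ)) r hessBlk0 force0 (addCol X (P i)) (P (i + 1)))
    (hC : SlackCert 𝓘 τ 0 sigmaOne hessBlk0 force0 (addCol X (P n)))
    (hF : AnnularPhaseFloor (63 / 10) (24 / 5) (63 / 10) (1 / 1000)) (hP : PolyTextureFloor (63 / 10) (24 / 5) (1 / 1000))
    (hA : AnnularDefectFloor (24 / 5) (63 / 10)) (hD : DefectiveCollarFloor (24 / 5))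
    (h2 : CrowdedCoreMotifPricingCapK (1 / 1000) (9 / 5) (133 / 10) (3 / 2) (effPot w₄₅ ω₄ (3 / 400)) (-(7175 / 10000) + 3 / 400)
      (Collar (9 / 2) fun N y j => (∃ s : ℝ, 0 ≤ s ∧ s ≤ 3 / 2 ∧ NonEquilibriumCore (-(7175 / 10000)) 0 7 s (1 / 10000) N y j) ∨
        GoodAtScale (1 / 20) (3 / 2) y j))
    (h3 : DiluteDefectMotifPricingCapK (1 / 1000) (9 / 5) (133 / 10) (3 / 2) (effPot w₄₅ ω₄ (3 / 400)) (-(7175 / 10000) + 3 / 400)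
      (Collar (9 / 2) fun N y j => (∃ s : ℝ, 0 ≤ s ∧ s ≤ 3 / 2 ∧ NonEquilibriumCore (-(7175 / 10000)) 0 7 s (1 / 10000) N y j) ∨
        GoodAtScale (1 / 20) (3 / 2) y j)) :
    Summit.AtomisticToContinuum.Crystallization.Theses.FrustratedLawDichotomy.PeriodicFrustratedLawGap :=
  periodicFrustratedLawGap_of_strainedPatchRec hε0 hε1 hU hDX hE
    (strainedPatchRec_of_homFloor_625_of_envelope_tailCert_tab P n hτ (homFloor_625_of_entryTrees6RBKP_HT4UQDCRX Pc Qf T hFcc hHcp) hT hRl hFC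
      hτs hsep hr7 hH hTC hdom h0 hs hC hF hP hA hD) h2 h3

/-- ★★★ **27623 FROM THE ENTRY TREES AND R1⁗ (census γ-table form, row-priced)**. [folklore instantiation] -/
theorem aperiodicFrustratedLawGap_of_entryTreesU_of_gammaTable_tailCert_tab {𝓘 : ChartFam} {τ s₀ r : ℝ} {L : ℝ → ℝ} {X Xh Xe : SlackTab}
    {εE CE DE DX : ℝ} (P : ℕ → SlackTab) (n : ℕ) (hτ : 0 ≤ τ)
    (hε0 : 0 < εE) (hε1 : εE ≤ 1 / 10000) (hU : PeriodicEnergyCeiling (-(7175 / 10000))) (hDX : 0 ≤ DX)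
    (hE : SchurElasticPricingX (1 / 20) (1 / 8) w₄₅ ω₄ (3 / 400) (-(7175 / 10000)) (1 / 10000) CE DE DX (LocOptFails eStar εE (3 / 2) 1))
    (Pc : ((Fin 3 × Fin 3) ⊕ Fin 3 → ℤ) → ((Fin 3 × Fin 3) ⊕ Fin 3 → ℤ) → HTCert)
    (Qf : ((Fin 3 × Fin 3) ⊕ Fin 3 → ℤ) → ((Fin 3 × Fin 3) ⊕ Fin 3 → ℤ) → (Fin 4 → ℤ))
    (T : ((Fin 3 × Fin 3) ⊕ Fin 3 → ℤ) → ((Fin 3 × Fin 3) ⊕ Fin 3 → ℤ) → CertTree ((Fin 3 × Fin 3) ⊕ Fin 3))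
    (hFcc : ∃ t : CertTree (Fin 3 × Fin 3), treeOK (entryLeafOK6RBKP muRec) t rootC rootW = true)
    (hHcp : ∃ t : CertTree ((Fin 3 × Fin 3) ⊕ Fin 3), treeOK (entryLeafOKHT4UQDCRX muRec Pc Qf T) t rootCH rootWH = true)
    (hT : TailPenalty (24 / 5) (1 / 1000)) (hRl : CoreCoreRelief (63 / 10) (63 / 10) (24 / 5) (1 / 100) (3 / 5000))
    (hFC : FamilyCover 𝓘 (24 / 5) (1 / 100) (1 / 8) τ) (hτs : 2 * τ < s₀)
    (hL : ∀ s : ℝ, s₀ ≤ s → s < r → ∀ s' : ℝ, |s' - s| ≤ 2 * τ → bondGamma s' ≤ L s) (hsep : HostSep 𝓘 s₀) (hr7 : r + 2 * τ ≤ 7)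
    (hH : HostFarTab 𝓘 τ r Xh) (hTC : TailCert 𝓘 τ Xe)
    (hdom : ∀ (M₀ : ℕ) (z₀ : Fin M₀ → E3) (c₀ h : Fin M₀), Xh M₀ z₀ c₀ h + Xe M₀ z₀ c₀ h ≤ X M₀ z₀ c₀ h)
    (h0 : HostTopTab 𝓘 τ bondD3 (cubicTail L) r (P 0))
    (hs : ∀ i : ℕ, i < n → HostStepTab 𝓘 τ sigmaOne bondD3 (cubicTail L) r hessBlk0 force0 (addCol X (P i)) (P (i + 1)))
    (hC : SlackCert 𝓘 τ 0 sigmaOne hessBlk0 force0 (addCol X (P n)))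
    (hF : AnnularPhaseFloor (63 / 10) (24 / 5) (63 / 10) (1 / 1000)) (hP : PolyTextureFloor (63 / 10) (24 / 5) (1 / 1000))
    (hA : AnnularDefectFloor (24 / 5) (63 / 10)) (hD : DefectiveCollarFloor (24 / 5))
    (h2 : CrowdedCoreMotifPricingCapK (1 / 1000) (9 / 5) (133 / 10) (3 / 2) (effPot w₄₅ ω₄ (3 / 400)) (-(7175 / 10000) + 3 / 400)
      (Collar (9 / 2) fun N y j => (∃ s : ℝ, 0 ≤ s ∧ s ≤ 3 / 2 ∧ NonEquilibriumCore (-(7175 / 10000)) 0 7 s (1 / 10000) N y j) ∨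
        GoodAtScale (1 / 20) (3 / 2) y j))
    (h3 : DiluteDefectMotifPricingCapK (1 / 1000) (9 / 5) (133 / 10) (3 / 2) (effPot w₄₅ ω₄ (3 / 400)) (-(7175 / 10000) + 3 / 400)
      (Collar (9 / 2) fun N y j => (∃ s : ℝ, 0 ≤ s ∧ s ≤ 3 / 2 ∧ NonEquilibriumCore (-(7175 / 10000)) 0 7 s (1 / 10000) N y j) ∨
        GoodAtScale (1 / 20) (3 / 2) y j)) :
    Summit.AtomisticToContinuum.Crystallization.Theses.FrustratedLawDichotomy.AperiodicFrustratedLawGap :=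
  aperiodicFrustratedLawGap_of_strainedPatchRec hε0 hε1 hU hDX hE
    (strainedPatchRec_of_homFloor_625_of_gammaTable_tailCert_tab P n hτ (homFloor_625_of_entryTrees6RBKP_HT4UQDCRX Pc Qf T hFcc hHcp) hT hRl hFC
      hτs hL hsep hr7 hH hTC hdom h0 hs hC hF hP hA hD) h2 h3

/-! ## §3 Sanity: the cell width of record `τ = 1/100`, ONE per-row step -/

/-- At `τ = 1/100` with one per-row step `P₀ ↦ P₁` the numeric side conditions of R1⁗ read `1/50 < s₀` and `r ≤ 349/50` (= `7 − 1/50`), exactly as for R1‴;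
the tables are `P₀` (per-row box top), `P₁` (per-row step bound on the column `addCol X P₀`), the certificate on `addCol X P₁`. [formal bookkeeping] -/
example {𝓘 : ChartFam} {s₀ r : ℝ} {X Xh Xe P₀ P₁ : SlackTab}
    (hHF : HomFloor (1 / 625)) (hT : TailPenalty (24 / 5) (1 / 1000)) (hRl : CoreCoreRelief (63 / 10) (63 / 10) (24 / 5) (1 / 100) (3 / 5000))
    (hFC : FamilyCover 𝓘 (24 / 5) (1 / 100) (1 / 8) (1 / 100)) (hs₀ : 1 / 50 < s₀) (hsep : HostSep 𝓘 s₀) (hr : r ≤ 349 / 50)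
    (hH : HostFarTab 𝓘 (1 / 100) r Xh) (hTC : TailCert 𝓘 (1 / 100) Xe)
    (hdom : ∀ (M₀ : ℕ) (z₀ : Fin M₀ → E3) (c₀ h : Fin M₀), Xh M₀ z₀ c₀ h + Xe M₀ z₀ c₀ h ≤ X M₀ z₀ c₀ h)
    (h0 : HostTopTab 𝓘 (1 / 100) bondD3 (cubicTail fun s => gammaMaj (s - 2 * (1 / 100))) r P₀)
    (h1 : HostStepTab 𝓘 (1 / 100) sigmaOne bondD3 (cubicTail fun s => gammaMaj (s - 2 * (1 / 100))) r hessBlk0 force0 (addCol X P₀) P₁)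
    (hC : SlackCert 𝓘 (1 / 100) 0 sigmaOne hessBlk0 force0 (addCol X P₁))
    (hF : AnnularPhaseFloor (63 / 10) (24 / 5) (63 / 10) (1 / 1000)) (hP : PolyTextureFloor (63 / 10) (24 / 5) (1 / 1000))
    (hA : AnnularDefectFloor (24 / 5) (63 / 10)) (hD : DefectiveCollarFloor (24 / 5)) : StrainedPatchRec :=
  strainedPatchRec_of_homFloor_625_of_envelope_tailCert_tab (fun i => if i = 0 then P₀ else P₁) 1 (by norm_num) hHF hT hRl hFC (by linarith) hsep
    (by linarith) hH hTC hdom (by simpa using h0) (fun i hi => by interval_cases i; simpa using h1) (by simpa using hC) hF hP hA hD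

end Summit.AtomisticToContinuum.Crystallization.Theorems.FrustratedLawDichotomyAperiodicGapRecordJunctionTab

end
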